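import Mathlib
import HarnessLib
import Summits.RiemannHypothesis.RiemannHypothesis.Theorems.PfPersistenceFfHandover
import Summits.RiemannHypothesis.RiemannHypothesis.Theorems.PfPersistenceFfWeilCriterionSharp

/-!
# Handover depth INSIDE the RH-true class, and sharpness of door D-D in the FE spelling
# (pub-rhpf, function-field mirror, separation side; helper lemmas)

Framing (verbatim, campaign rule): mechanism/rigidity campaign; no RH claims.  Function-field RH
statements below are theorems about explicit polynomials (Weil); nothing here bears on ζ.

Companion to `PfPersistenceFfHandover` (door D-E, HANDOVER DEPTH: on monic, degree-`2g`,
coefficient-FE data the window `T_M(q, h)` determines `h` iff `g ≤ M`).  This file records that the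
threshold `g` is sharp EVEN INSIDE THE RH-TRUE part of the class — the part containing every genuine
datum — so below depth `g` a window cannot even tell WHICH RH-true honest datum it is looking at:

* `rh_X_pow_add_C`: every complex root of `x^{2g} + q^g` has modulus `√q` (`α^{2g} = -q^g`);
* `rh_X_pow_add_C_dial`: for `1 ≤ q`, every complex root of `x^{2g} + x^g + q^g` has modulus `√q`
  (`y = α^g` solves `y² + y + q^g = 0`, a real quadratic with negative discriminant, so `y` is not real
  and `|y|² = y·ȳ = q^g` — `norm_sq_eq_of_sq_add_self_add`);
* `weilWindowForm_injOn_fe_rh_iff`: for `0 < q`, `1 ≤ g`: `h ↦ T_M(q, h)` is injective on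
  {monic, degree `2g`, coefficient FE, all roots of modulus `√q`} iff `g ≤ M` — above `g` by
  `weilWindowForm_injOn_fe_iff`, below `g` the two RH-true data above collide (`weilWindowForm_dial`).
* `hSharp_fe`, `sharp_witness_fe`: the depth witness `h♯ = x⁴ - 5x³ + 8x² - 20x + 16` (`q = 4`, `g = 2`)
  of `PfPersistenceFfWeilCriterionSharp` satisfies the COEFFICIENT functional equation, so the depth
  `2g - 1` of the FE-spelled criterion (`weilWindowForm_posSemidef_twoG_iff_of_fe`; rhdoor ff-1's
  `weilWindowForm_posSemidef_depth_iff_ffRH`) cannot be lowered either (RULING A235 (P3) in kernel form).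

All statements are over existing declarations (`frobRoots`, `weilWindowForm` of `PfPersistenceFfAngleTwin`;
`hSharp`, `sharp_witness` of `PfPersistenceFfWeilCriterionSharp`; `monic_dial`, `weilWindowForm_dial` of
`PfPersistenceFfDialPrefix`; `fe_X_pow_add_C`, `dial_ne`, `weilWindowForm_injOn_fe_iff` of
`PfPersistenceFfHandover`; rhdoor ff-1's `MotivicDoor.FunctionField.fe_dial`).  Labels: PROVED = the
theorems below; no DATA.
-/

set_option linter.dupNamespace false

open Polynomial Finset
open scoped ComplexOrder
open Summit.RiemannHypothesis.RiemannHypothesis.Theorems.MotivicDoor.FunctionField (fe_dial)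

namespace Summit.RiemannHypothesis.RiemannHypothesis.Theorems.PfPersistence.FfAngleTwin

/-! ## Two RH-true honest data in every dimension `g ≥ 1` -/

/-- `‖α‖^{2g} = q^g` (with `g ≥ 1`) forces `‖α‖ = √q`. [folklore] -/
theorem norm_eq_sqrt_of_pow_eq {α : ℂ} {q : ℕ} {g : ℕ} (hg : 1 ≤ g)
    (h : ‖α‖ ^ (2 * g) = (q : ℝ) ^ g) : ‖α‖ = Real.sqrt q := by
  have h2 : (‖α‖ ^ 2) ^ g = (q : ℝ) ^ g := by rw [← pow_mul]; exact h
  have hsq : ‖α‖ ^ 2 = (q : ℝ) :=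
    (pow_left_inj₀ (by positivity) (Nat.cast_nonneg q) (by omega)).mp h2
  rw [← hsq, Real.sqrt_sq (norm_nonneg α)]

/-- RH for `x^{2g} + q^g`: every complex root has modulus `√q` (`α^{2g} = -q^g`). [folklore] -/
theorem rh_X_pow_add_C (q : ℕ) {g : ℕ} (hg : 1 ≤ g) :
    ∀ α ∈ frobRoots (X ^ (2 * g) + C ((q : ℤ) ^ g)), ‖α‖ = Real.sqrt q := by
  intro α hα
  have hroot := (Polynomial.mem_roots'.mp hα).2
  have hev : α ^ (2 * g) + (q : ℂ) ^ g = 0 := by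
    have h0 := hroot.eq_zero
    simpa [Polynomial.eval_map] using h0
  have hpow : α ^ (2 * g) = -((q : ℂ) ^ g) := eq_neg_of_add_eq_zero_left hev
  have hnorm : ‖α‖ ^ (2 * g) = (q : ℝ) ^ g := by
    have := congrArg (fun z : ℂ => ‖z‖) hpow
    simpa [norm_pow, norm_neg] using this
  exact norm_eq_sqrt_of_pow_eq hg hnorm

/-- A complex root `y` of the REAL quadratic `y² + y + c` with `1 ≤ c` (negative discriminant) is not
real, its conjugate is the other root, and `|y|² = y ȳ = c`. [folklore] -/
theorem norm_sq_eq_of_sq_add_self_add {y : ℂ} {c : ℝ} (hc : 1 ≤ c) (hy : y ^ 2 + y + c = 0) :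
    ‖y‖ ^ 2 = c := by
  have hy' : (starRingEnd ℂ y) ^ 2 + starRingEnd ℂ y + c = 0 := by
    have := congrArg (starRingEnd ℂ) hy
    simpa [map_add, map_pow, Complex.conj_ofReal] using this
  have hne : starRingEnd ℂ y ≠ y := by
    intro hreal
    have hyre : (y.re : ℂ) = y := Complex.conj_eq_iff_re.mp hreal
    have hR : y.re ^ 2 + y.re + c = 0 := by
      have h1 := hy
      rw [← hyre] at h1
      exact_mod_cast h1
    nlinarith [sq_nonneg (y.re + 1 / 2)]
  have hsum : starRingEnd ℂ y = -1 - y := by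
    have h0 : (y - starRingEnd ℂ y) * (y + starRingEnd ℂ y + 1) = 0 := by
      linear_combination hy - hy'
    rcases mul_eq_zero.mp h0 with h1 | h1
    · exact absurd (sub_eq_zero.mp h1).symm hne
    · linear_combination h1
  have hprod : y * starRingEnd ℂ y = c := by
    rw [hsum]
    linear_combination (-1 : ℂ) * hy
  have h1 : ((Complex.normSq y : ℝ) : ℂ) = (c : ℂ) := by rw [← Complex.mul_conj, hprod]
  have h2 : Complex.normSq y = c := by exact_mod_cast h1
  rw [← Complex.normSq_eq_norm_sq]
  exact h2

/-- RH for `x^{2g} + x^g + q^g` (`1 ≤ q`): every complex root has modulus `√q` — with `y = α^g`,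
`y² + y + q^g = 0`, so `|α|^{2g} = |y|² = q^g`. [folklore] -/
theorem rh_X_pow_add_C_dial {q : ℕ} (hq : 1 ≤ q) {g : ℕ} (hg : 1 ≤ g) :
    ∀ α ∈ frobRoots (X ^ (2 * g) + C ((q : ℤ) ^ g) + C 1 * X ^ g), ‖α‖ = Real.sqrt q := by
  intro α hα
  have hroot := (Polynomial.mem_roots'.mp hα).2
  have hev0 : α ^ (2 * g) + (q : ℂ) ^ g + α ^ g = 0 := by
    have h0 := hroot.eq_zero
    simpa [Polynomial.eval_map] using h0
  have hev : (α ^ g) ^ 2 + α ^ g + (((q : ℝ) ^ g : ℝ) : ℂ) = 0 := by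
    push_cast
    linear_combination hev0
  have hc : (1 : ℝ) ≤ (q : ℝ) ^ g := one_le_pow₀ (by exact_mod_cast hq)
  have hy := norm_sq_eq_of_sq_add_self_add hc hev
  have hnorm : ‖α‖ ^ (2 * g) = (q : ℝ) ^ g := by
    rw [mul_comm, pow_mul, ← norm_pow]
    exact hy
  exact norm_eq_sqrt_of_pow_eq hg hnorm

/-! ## Handover depth inside the RH-true class -/

/-- HANDOVER DEPTH INSIDE THE RH-TRUE CLASS: for `0 < q`, `1 ≤ g` and any `M`, `h ↦ T_M(q, h)` is
injective on {monic, degree `2g`, coefficient FE, every root of modulus `√q`} iff `g ≤ M`.  Above `g`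
this is `weilWindowForm_injOn_fe_iff` restricted; below `g` the RH-true data `x^{2g} + q^g` and
`x^{2g} + x^g + q^g` have the same window (`weilWindowForm_dial`).  So a window of size `≤ g - 1`
cannot tell two RH-TRUE honest data of the same dimension apart, let alone read a property of one of
them. [folklore] -/
theorem weilWindowForm_injOn_fe_rh_iff {q : ℕ} (hq : 0 < q) {g : ℕ} (hg : 1 ≤ g) (M : ℕ) :
    Set.InjOn (fun h : ℤ[X] => weilWindowForm (q : ℝ) h M)
      {h : ℤ[X] | h.Monic ∧ h.natDegree = 2 * g ∧
        (∀ i j, i + j = 2 * g → (q : ℤ) ^ g * h.coeff j = (q : ℤ) ^ i * h.coeff i) ∧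
        ∀ α ∈ frobRoots h, ‖α‖ = Real.sqrt q} ↔ g ≤ M := by
  constructor
  · intro hinj
    by_contra hle
    have hM : M + 1 ≤ g := by omega
    obtain ⟨hm₀, hd₀, hFE₀⟩ := fe_X_pow_add_C q hg
    obtain ⟨hm₁, hd₁⟩ := monic_dial hm₀ hd₀ hg 1
    have heq : weilWindowForm (q : ℝ) (X ^ (2 * g) + C ((q : ℤ) ^ g) + C 1 * X ^ g) M
        = weilWindowForm (q : ℝ) (X ^ (2 * g) + C ((q : ℤ) ^ g)) M :=
      weilWindowForm_dial (q : ℝ) hm₀ hd₀ 1 hM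
    have h1 : (X ^ (2 * g) + C ((q : ℤ) ^ g) + C 1 * X ^ g : ℤ[X]) ∈
        {h : ℤ[X] | h.Monic ∧ h.natDegree = 2 * g ∧
          (∀ i j, i + j = 2 * g → (q : ℤ) ^ g * h.coeff j = (q : ℤ) ^ i * h.coeff i) ∧
          ∀ α ∈ frobRoots h, ‖α‖ = Real.sqrt q} :=
      ⟨hm₁, hd₁, fe_dial hFE₀ 1, rh_X_pow_add_C_dial hq hg⟩
    have h0 : (X ^ (2 * g) + C ((q : ℤ) ^ g) : ℤ[X]) ∈
        {h : ℤ[X] | h.Monic ∧ h.natDegree = 2 * g ∧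
          (∀ i j, i + j = 2 * g → (q : ℤ) ^ g * h.coeff j = (q : ℤ) ^ i * h.coeff i) ∧
          ∀ α ∈ frobRoots h, ‖α‖ = Real.sqrt q} :=
      ⟨hm₀, hd₀, hFE₀, rh_X_pow_add_C q hg⟩
    exact dial_ne _ g one_ne_zero (hinj h1 h0 heq)
  · intro hM h₁ hh₁ h₂ hh₂ heq
    have hh₁' : h₁ ∈ {h : ℤ[X] | h.Monic ∧ h.natDegree = 2 * g ∧
        ∀ i j, i + j = 2 * g → (q : ℤ) ^ g * h.coeff j = (q : ℤ) ^ i * h.coeff i} :=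
      ⟨hh₁.1, hh₁.2.1, hh₁.2.2.1⟩
    have hh₂' : h₂ ∈ {h : ℤ[X] | h.Monic ∧ h.natDegree = 2 * g ∧
        ∀ i j, i + j = 2 * g → (q : ℤ) ^ g * h.coeff j = (q : ℤ) ^ i * h.coeff i} :=
      ⟨hh₂.1, hh₂.2.1, hh₂.2.2.1⟩
    exact (weilWindowForm_injOn_fe_iff hq hg M).mpr hM hh₁' hh₂' heq

/-- Packaged: in every dimension `g ≥ 1` and at every `q ≥ 1` there are two DISTINCT RH-true honest data
(monic, degree `2g`, coefficient FE, all roots of modulus `√q`) with identical windows `T_M` for every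
`M ≤ g - 1`. [folklore] -/
theorem exists_rhTrue_fe_collision_below {q : ℕ} (hq : 1 ≤ q) {g : ℕ} (hg : 1 ≤ g) :
    ∃ h₀ h₁ : ℤ[X], h₀ ≠ h₁ ∧
      (h₀.Monic ∧ h₀.natDegree = 2 * g ∧
        (∀ i j, i + j = 2 * g → (q : ℤ) ^ g * h₀.coeff j = (q : ℤ) ^ i * h₀.coeff i) ∧
        ∀ α ∈ frobRoots h₀, ‖α‖ = Real.sqrt q) ∧
      (h₁.Monic ∧ h₁.natDegree = 2 * g ∧
        (∀ i j, i + j = 2 * g → (q : ℤ) ^ g * h₁.coeff j = (q : ℤ) ^ i * h₁.coeff i) ∧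
        ∀ α ∈ frobRoots h₁, ‖α‖ = Real.sqrt q) ∧
      ∀ M, M + 1 ≤ g → weilWindowForm (q : ℝ) h₀ M = weilWindowForm (q : ℝ) h₁ M := by
  obtain ⟨hm₀, hd₀, hFE₀⟩ := fe_X_pow_add_C q hg
  obtain ⟨hm₁, hd₁⟩ := monic_dial hm₀ hd₀ hg 1
  exact ⟨X ^ (2 * g) + C ((q : ℤ) ^ g), X ^ (2 * g) + C ((q : ℤ) ^ g) + C 1 * X ^ g,
    (dial_ne _ g one_ne_zero).symm, ⟨hm₀, hd₀, hFE₀, rh_X_pow_add_C q hg⟩,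
    ⟨hm₁, hd₁, fe_dial hFE₀ 1, rh_X_pow_add_C_dial hq hg⟩,
    fun M hM => (weilWindowForm_dial (q : ℝ) hm₀ hd₀ 1 hM).symm⟩

/-! ## Sharpness of door D-D in the FE spelling -/

/-- The coefficients of `h♯ = x⁴ - 5x³ + 8x² - 20x + 16`, `C`-spelled. [folklore] -/
theorem hSharp_eq : hSharp = C 1 * X ^ 4 + C (-5) * X ^ 3 + C 8 * X ^ 2 + C (-20) * X + C 16 := by
  simp only [hSharp, map_one, one_mul, map_neg, neg_mul, map_ofNat]
  ring

/-- `h♯` is monic. [folklore] -/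
theorem hSharp_monic : hSharp.Monic := by
  rw [Monic, leadingCoeff, natDegree_hSharp, hSharp_eq]
  simp [coeff_X_pow, coeff_X]

/-- `h♯` satisfies the COEFFICIENT functional equation at `q = 4`, `g = 2`:
`4² c_j = 4^i c_i` for `i + j = 4` (`(0,4)`: `16·1 = 1·16`; `(1,3)`: `16·(-5) = 4·(-20)`; `(2,2)` trivially;
and the mirrored pairs). [folklore] -/
theorem hSharp_fe : ∀ i j, i + j = 2 * 2 → (4 : ℤ) ^ 2 * hSharp.coeff j = (4 : ℤ) ^ i * hSharp.coeff i := by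
  intro i j hij
  have hi : i ≤ 4 := by omega
  interval_cases i
  · obtain rfl : j = 4 := by omega
    simp [hSharp_eq, coeff_X_pow, coeff_X]
  · obtain rfl : j = 3 := by omega
    simp [hSharp_eq, coeff_X_pow, coeff_X]
  · obtain rfl : j = 2 := by omega
    rfl
  · obtain rfl : j = 1 := by omega
    simp [hSharp_eq, coeff_X_pow, coeff_X]
  · obtain rfl : j = 0 := by omega
    simp [hSharp_eq, coeff_X_pow, coeff_X]

/-- SHARPNESS OF DOOR D-D IN THE FE SPELLING (RULING A235 (P3), kernel form): the depth witness `h♯` of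
`PfPersistenceFfWeilCriterionSharp` is an honest datum in the coefficient-FE sense — monic, degree
`4 = 2g` with `g = 2`, coefficient FE at `q = 4` — with RH(4, h♯) FALSE, `T_{2g-2} = T_2 ⪰ 0` and
`T_{2g-1} = T_3` not `⪰ 0`; so the depth `2g - 1` in `weilWindowForm_posSemidef_twoG_iff_of_fe` (and in
rhdoor ff-1's `weilWindowForm_posSemidef_depth_iff_ffRH`) cannot be lowered to `2g - 2`. [folklore] -/
theorem sharp_witness_fe :
    hSharp.Monic ∧ hSharp.natDegree = 2 * 2 ∧
    (∀ i j, i + j = 2 * 2 → ((4 : ℕ) : ℤ) ^ 2 * hSharp.coeff j = ((4 : ℕ) : ℤ) ^ i * hSharp.coeff i) ∧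
    ¬ (∀ α ∈ frobRoots hSharp, ‖α‖ = Real.sqrt (4 : ℕ)) ∧
    (weilWindowForm ((4 : ℕ) : ℝ) hSharp 2).PosSemidef ∧
    ¬ (weilWindowForm ((4 : ℕ) : ℝ) hSharp 3).PosSemidef := by
  obtain ⟨-, -, -, hrh, hpsd, hnpsd⟩ := sharp_witness
  refine ⟨hSharp_monic, by rw [natDegree_hSharp], ?_, ?_, ?_, ?_⟩
  · simpa using hSharp_fe
  · simpa using hrh
  · simpa using hpsd
  · simpa using hnpsd

end Summit.RiemannHypothesis.RiemannHypothesis.Theorems.PfPersistence.FfAngleTwin
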